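import Summits.QuantumFields.QCD.Theses.HeatSlicedQuarks
import Summits.QuantumFields.QCD.Theorems.HeatSlicedQuarksQuarkLoopCoefficientDefs
import Summits.QuantumFields.QCD.Theorems.HeatSlicedQuarksQuarkLoopCoefficientHeatSeries
import Summits.QuantumFields.QCD.Theorems.HeatSlicedQuarksQuarkLoopCoefficientSecondOrderCoefficientAux

/-!
# Free heat calculus on `ℤ⁴`, part A: lattice geometry and the Fourier coefficients `ĥ`
(line `Sketch` of crux stmt-QuantumFields-16786, helper file of the stub `stub_freeHeatCalculus`)

Elementary facts about the objects `nbr`, `nbr2`, `hhat` of `HeatSlicedQuarksQuarkLoopCoefficientDefs`: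

* geometry of `ℤ⁴`: translation of the neighbourhoods (`y ∈ nbr2 x ↔ y − x ∈ nbr2 0`), symmetry
  under negation, reindexing of sums over `nbr2 x`, the memberships of `0, ±e_μ, ±e_μ ± e_ν` in
  `nbr2 0`;
* the Fourier coefficients `hhat` as an explicit combination of indicators of the `33` vectors
  `0, ±e_μ, ±e_μ ± e_ν (μ ≠ ν)` (`hhat_eq_indicator`; the finite part is a `decide` over the box
  `{−1,0,1}⁴`), whence the `33`-term expansion of `Σ_{z ∈ nbr2 0} ĥ(z) • f z` (`sum_nbr2_hhat_smul`)
  used by the symbol identities of part B and by the free `D♯D` computation.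

Implementation note: the closed `Finset` terms `nbr 0`, `nbr2 0` are computable and the elaborator
unfolds them completely whenever a lemma is applied to the numeral `0 : Site 4` in a position feeding a
membership; such memberships are therefore always supplied by unification (`self_mem_nbr2 _`).
-/

noncomputable section

namespace Summit.QuantumFields.QCD.Cruxes.QuarkLoopCoefficient.Sketch.FreeHeatCalculus

open Literature.MathematicalPhysics.QuantumLattice Literature.MathematicalPhysics.QuantumFieldTheory
open Literature.Probability.LatticeModels (Site)
open Summit.QuantumFields.QCD.Theorems.QuarkLoopCoefficient
open Summit.QuantumFields.QCD.Cruxes.QuarkLoopCoefficient.Sketch.HeatSeries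
open scoped Matrix ComplexConjugate

-- `add_mem_nbr2_zero` (sums of two range-one vectors are range-two) is reused from the landed
-- `…SecondOrderCoefficientAux` (namespace `…Sketch.SecondOrderCoefficient`).

/-! ## §1 `ℓ¹`-geometry of `ℤ⁴` -/

/-- A coordinate is bounded by the `ℓ¹` norm. -/
theorem abs_apply_le_sum_abs (w : Site 4) (μ : Fin 4) : |w μ| ≤ ∑ ν : Fin 4, |w ν| :=
  Finset.single_le_sum (f := fun ν => |w ν|) (fun ν _ => abs_nonneg (w ν)) (Finset.mem_univ μ)

/-- Translation of the range-one neighbourhood to the origin. -/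
theorem mem_nbr_iff_sub {x y : Site 4} : y ∈ nbr x ↔ y - x ∈ nbr 0 := by
  rw [mem_nbr, mem_nbr]
  simp only [zero_add, zero_sub, add_zero, sub_eq_iff_eq_add', ← sub_eq_add_neg]

/-- Translation of the range-two neighbourhood to the origin. -/
theorem mem_nbr2_iff_sub {x y : Site 4} : y ∈ nbr2 x ↔ y - x ∈ nbr2 0 := by
  rw [mem_nbr2, mem_nbr2]
  constructor
  · rintro ⟨z, hz, hyz⟩
    refine ⟨z - x, mem_nbr_iff_sub.mp hz, ?_⟩
    rw [mem_nbr_iff_sub] at hyz ⊢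
    rwa [sub_sub_sub_cancel_right]
  · rintro ⟨z, hz, hyz⟩
    refine ⟨z + x, mem_nbr_iff_sub.mpr (by rwa [add_sub_cancel_right]), ?_⟩
    rw [mem_nbr_iff_sub] at hyz ⊢
    rwa [sub_add_eq_sub_sub_swap]

/-- `nbr 0` is symmetric under negation (one direction). -/
theorem neg_mem_nbr_zero {z : Site 4} (hz : z ∈ nbr 0) : -z ∈ nbr 0 := by
  rcases mem_nbr.mp hz with h | ⟨μ, h | h⟩
  · exact mem_nbr.mpr (Or.inl (by rw [h, neg_zero]))
  · exact mem_nbr.mpr (Or.inr ⟨μ, Or.inr (by rw [h, zero_add, zero_sub])⟩)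
  · exact mem_nbr.mpr (Or.inr ⟨μ, Or.inl (by rw [h, zero_sub, neg_neg, zero_add])⟩)

/-- `nbr2 0` is symmetric under negation (one direction). -/
theorem neg_mem_nbr2_zero {z : Site 4} (hz : z ∈ nbr2 0) : -z ∈ nbr2 0 := by
  obtain ⟨a, ha, hza⟩ := (mem_nbr2 (x := 0) (y := z)).mp hz
  rw [mem_nbr_iff_sub] at hza
  have h1 : -z - -a ∈ nbr 0 := by
    have : -z - -a = -(z - a) := by abel
    rw [this]
    exact neg_mem_nbr_zero hza
  have h2 : -z ∈ nbr (-a) := (mem_nbr_iff_sub (x := -a) (y := -z)).mpr h1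
  exact (mem_nbr2 (x := 0) (y := -z)).mpr ⟨-a, neg_mem_nbr_zero ha, h2⟩

/-- `nbr2 0` is symmetric under negation. -/
theorem neg_mem_nbr2_zero_iff {z : Site 4} : -z ∈ nbr2 0 ↔ z ∈ nbr2 0 :=
  ⟨fun h => by simpa using neg_mem_nbr2_zero h, neg_mem_nbr2_zero⟩

/-- Translation of a sum over `nbr2 x` to a sum over `nbr2 0`. -/
theorem sum_nbr2_translate {M : Type*} [AddCommMonoid M] (x : Site 4) (g : Site 4 → M) :
    ∑ z ∈ nbr2 x, g z = ∑ v ∈ nbr2 0, g (x + v) :=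
  Finset.sum_nbij' (fun z => z - x) (fun v => x + v) (fun _ hz => mem_nbr2_iff_sub.mp hz)
    (fun v hv => by rwa [mem_nbr2_iff_sub, add_sub_cancel_left]) (fun z _ => by abel)
    (fun v _ => by abel) (fun z _ => by rw [add_sub_cancel])

/-- A sum over `nbr2 0` is invariant under negation of the summation variable. -/
theorem sum_nbr2_neg {M : Type*} [AddCommMonoid M] (g : Site 4 → M) :
    ∑ v ∈ nbr2 0, g (-v) = ∑ v ∈ nbr2 0, g v :=
  Finset.sum_nbij' (fun v => -v) (fun v => -v) (fun _ hv => neg_mem_nbr2_zero hv)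
    (fun _ hv => neg_mem_nbr2_zero hv) (fun v _ => neg_neg v) (fun v _ => neg_neg v) (fun _ _ => rfl)

/-- `e_μ ∈ nbr 0`. -/
theorem single_mem_nbr_zero (μ : Fin 4) : (Pi.single μ 1 : Site 4) ∈ nbr 0 := by
  simpa using add_single_mem_nbr 0 μ

/-- `−e_μ ∈ nbr 0`. -/
theorem neg_single_mem_nbr_zero (μ : Fin 4) : (-Pi.single μ 1 : Site 4) ∈ nbr 0 := by
  simpa using sub_single_mem_nbr 0 μ

/-- `0 ∈ nbr 0`. -/
theorem zero_mem_nbr_zero : (0 : Site 4) ∈ nbr 0 := self_mem_nbr _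

/-- `e_μ ∈ nbr2 0`. -/
theorem single_mem_nbr2_zero (μ : Fin 4) : (Pi.single μ 1 : Site 4) ∈ nbr2 0 := by
  simpa using SecondOrderCoefficient.add_mem_nbr2_zero zero_mem_nbr_zero (single_mem_nbr_zero μ)

/-- `−e_μ ∈ nbr2 0`. -/
theorem neg_single_mem_nbr2_zero (μ : Fin 4) : (-Pi.single μ 1 : Site 4) ∈ nbr2 0 := by
  simpa using SecondOrderCoefficient.add_mem_nbr2_zero zero_mem_nbr_zero (neg_single_mem_nbr_zero μ)

/-- `e_μ + e_ν ∈ nbr2 0`. -/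
theorem single_add_single_mem_nbr2_zero (μ ν : Fin 4) :
    (Pi.single μ 1 + Pi.single ν 1 : Site 4) ∈ nbr2 0 :=
  SecondOrderCoefficient.add_mem_nbr2_zero (single_mem_nbr_zero μ) (single_mem_nbr_zero ν)

/-- `e_μ − e_ν ∈ nbr2 0`. -/
theorem single_sub_single_mem_nbr2_zero (μ ν : Fin 4) :
    (Pi.single μ 1 - Pi.single ν 1 : Site 4) ∈ nbr2 0 := by
  rw [sub_eq_add_neg]
  exact SecondOrderCoefficient.add_mem_nbr2_zero (single_mem_nbr_zero μ) (neg_single_mem_nbr_zero ν)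

/-- `−e_μ + e_ν ∈ nbr2 0`. -/
theorem neg_single_add_single_mem_nbr2_zero (μ ν : Fin 4) :
    (-Pi.single μ 1 + Pi.single ν 1 : Site 4) ∈ nbr2 0 :=
  SecondOrderCoefficient.add_mem_nbr2_zero (neg_single_mem_nbr_zero μ) (single_mem_nbr_zero ν)

/-- `−e_μ − e_ν ∈ nbr2 0`. -/
theorem neg_single_sub_single_mem_nbr2_zero (μ ν : Fin 4) :
    (-Pi.single μ 1 - Pi.single ν 1 : Site 4) ∈ nbr2 0 := by
  rw [sub_eq_add_neg]
  exact SecondOrderCoefficient.add_mem_nbr2_zero (neg_single_mem_nbr_zero μ) (neg_single_mem_nbr_zero ν)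

/-! ## §2 The Fourier coefficients `hhat` -/

/-- `ĥ` is even. -/
theorem hhat_neg (z : Site 4) : hhat (-z) = hhat z := by
  unfold hhat
  simp only [neg_eq_zero, Pi.neg_apply, abs_neg]

/-- `|ĥ(z)| ≤ 20`. -/
theorem abs_hhat_le (z : Site 4) : |hhat z| ≤ 20 := by
  unfold hhat
  split_ifs <;> norm_num

/-- Integers of absolute value at most one are `a − 1` for some `a : Fin 3`. -/
theorem exists_fin_three_of_abs_le_one {k : ℤ} (hk : |k| ≤ 1) : ∃ a : Fin 3, k = (a : ℕ) - 1 := by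
  obtain ⟨h1, h2⟩ := abs_le.mp hk
  interval_cases k
  exacts [⟨0, by simp⟩, ⟨1, by simp⟩, ⟨2, by simp⟩]

/-- A vector of the box `{−1,0,1}⁴` is a `Fin 3`-tuple shifted by one. -/
theorem exists_box_repr {w : Site 4} (hw : ∀ μ : Fin 4, |w μ| ≤ 1) :
    ∃ a b c d : Fin 3, w = ![((a : ℕ) : ℤ) - 1, ((b : ℕ) : ℤ) - 1, ((c : ℕ) : ℤ) - 1, ((d : ℕ) : ℤ) - 1] := by
  obtain ⟨a, ha⟩ := exists_fin_three_of_abs_le_one (hw 0)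
  obtain ⟨b, hb⟩ := exists_fin_three_of_abs_le_one (hw 1)
  obtain ⟨c, hc⟩ := exists_fin_three_of_abs_le_one (hw 2)
  obtain ⟨d, hd⟩ := exists_fin_three_of_abs_le_one (hw 3)
  refine ⟨a, b, c, d, ?_⟩
  funext i
  fin_cases i
  · simpa using ha
  · simpa using hb
  · simpa using hc
  · simpa using hd

set_option maxRecDepth 8000 in
/-- The shell-one indicator identity on the box `{−1,0,1}⁴` (a finite check). -/
theorem box_shell_one : ∀ a b c d : Fin 3,
    (∑ μ : Fin 4,
      ((if (![((a : ℕ) : ℤ) - 1, ((b : ℕ) : ℤ) - 1, ((c : ℕ) : ℤ) - 1, ((d : ℕ) : ℤ) - 1] : Site 4) =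
          Pi.single μ 1 then (1 : ℤ) else 0) +
        (if (![((a : ℕ) : ℤ) - 1, ((b : ℕ) : ℤ) - 1, ((c : ℕ) : ℤ) - 1, ((d : ℕ) : ℤ) - 1] : Site 4) =
          -Pi.single μ 1 then (1 : ℤ) else 0))) =
      if (∑ μ : Fin 4, |(![((a : ℕ) : ℤ) - 1, ((b : ℕ) : ℤ) - 1, ((c : ℕ) : ℤ) - 1, ((d : ℕ) : ℤ) - 1] :
        Site 4) μ|) = 1 then 1 else 0 := by
  decide

set_option maxRecDepth 8000 in
/-- The shell-two indicator identity on the box `{−1,0,1}⁴` (a finite check). -/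
theorem box_shell_two : ∀ a b c d : Fin 3,
    (∑ μ : Fin 4, ∑ ν : Fin 4, (if μ = ν then (0 : ℤ) else
      ((if (![((a : ℕ) : ℤ) - 1, ((b : ℕ) : ℤ) - 1, ((c : ℕ) : ℤ) - 1, ((d : ℕ) : ℤ) - 1] : Site 4) =
          Pi.single μ 1 + Pi.single ν 1 then (1 : ℤ) else 0) +
       (if (![((a : ℕ) : ℤ) - 1, ((b : ℕ) : ℤ) - 1, ((c : ℕ) : ℤ) - 1, ((d : ℕ) : ℤ) - 1] : Site 4) =
          Pi.single μ 1 - Pi.single ν 1 then (1 : ℤ) else 0) +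
       (if (![((a : ℕ) : ℤ) - 1, ((b : ℕ) : ℤ) - 1, ((c : ℕ) : ℤ) - 1, ((d : ℕ) : ℤ) - 1] : Site 4) =
          -Pi.single μ 1 + Pi.single ν 1 then (1 : ℤ) else 0) +
       (if (![((a : ℕ) : ℤ) - 1, ((b : ℕ) : ℤ) - 1, ((c : ℕ) : ℤ) - 1, ((d : ℕ) : ℤ) - 1] : Site 4) =
          -Pi.single μ 1 - Pi.single ν 1 then (1 : ℤ) else 0)))) =
      if (∑ μ : Fin 4, |(![((a : ℕ) : ℤ) - 1, ((b : ℕ) : ℤ) - 1, ((c : ℕ) : ℤ) - 1, ((d : ℕ) : ℤ) - 1] :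
          Site 4) μ|) = 2 ∧
        (∀ μ : Fin 4, |(![((a : ℕ) : ℤ) - 1, ((b : ℕ) : ℤ) - 1, ((c : ℕ) : ℤ) - 1, ((d : ℕ) : ℤ) - 1] :
          Site 4) μ| ≤ 1) then 2 else 0 := by
  decide

/-- Coordinates of `±e_μ` are bounded by one. -/
theorem abs_single_apply_le (μ ν : Fin 4) (s : ℤ) (hs : |s| ≤ 1) :
    |(s • (Pi.single μ (1 : ℤ) : Site 4)) ν| ≤ 1 := by
  rw [Pi.smul_apply, Pi.single_apply]
  split_ifs <;> simp [hs]

/-- Coordinates of `±e_μ ± e_ν` (`μ ≠ ν`) are bounded by one. -/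
theorem abs_shell_two_apply_le {μ ν : Fin 4} (h : μ ≠ ν) (κ : Fin 4) (s s' : ℤ) (hs : |s| ≤ 1)
    (hs' : |s'| ≤ 1) :
    |(s • (Pi.single μ (1 : ℤ) : Site 4) + s' • (Pi.single ν (1 : ℤ) : Site 4)) κ| ≤ 1 := by
  rw [Pi.add_apply, Pi.smul_apply, Pi.smul_apply, Pi.single_apply, Pi.single_apply]
  by_cases h1 : κ = μ
  · simp [h1, hs, h]
  · by_cases h2 : κ = ν
    · have h3 : ν ≠ μ := fun e => h e.symm
      simp [h2, h3, hs']
    · simp [h1, h2]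

/-- The shell-one indicator identity: `Σ_μ ([w = e_μ] + [w = −e_μ]) = [‖w‖₁ = 1]`. -/
theorem shell_one_indicator (w : Site 4) :
    (∑ μ : Fin 4, ((if w = Pi.single μ 1 then (1 : ℝ) else 0) + (if w = -Pi.single μ 1 then 1 else 0))) =
      if (∑ μ : Fin 4, |w μ|) = 1 then 1 else 0 := by
  by_cases hbox : ∀ μ : Fin 4, |w μ| ≤ 1
  · obtain ⟨a, b, c, d, hw⟩ := exists_box_repr hbox
    have key := box_shell_one a b c d
    rw [hw]
    exact_mod_cast key
  · push Not at hbox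
    obtain ⟨κ, hκ⟩ := hbox
    have hN : (∑ μ : Fin 4, |w μ|) ≠ 1 := by
      have := abs_apply_le_sum_abs w κ
      intro e; rw [e] at this; linarith
    rw [if_neg hN]
    refine Finset.sum_eq_zero fun μ _ => ?_
    have h1 : w ≠ Pi.single μ 1 := by
      intro e
      have := abs_single_apply_le μ κ 1 (by simp)
      rw [one_smul, ← e] at this
      linarith
    have h2 : w ≠ -Pi.single μ 1 := by
      intro e
      have := abs_single_apply_le μ κ (-1) (by simp)
      rw [neg_smul, one_smul, ← e] at this
      linarith
    rw [if_neg h1, if_neg h2, add_zero]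

/-- The shell-two indicator identity:
`Σ_{μ ≠ ν} ([w = e_μ+e_ν] + [w = e_μ−e_ν] + [w = −e_μ+e_ν] + [w = −e_μ−e_ν]) = 2·[‖w‖₁ = 2 ∧ ‖w‖_∞ ≤ 1]`. -/
theorem shell_two_indicator (w : Site 4) :
    (∑ μ : Fin 4, ∑ ν : Fin 4, (if μ = ν then (0 : ℝ) else
      ((if w = Pi.single μ 1 + Pi.single ν 1 then (1 : ℝ) else 0) +
       (if w = Pi.single μ 1 - Pi.single ν 1 then (1 : ℝ) else 0) +
       (if w = -Pi.single μ 1 + Pi.single ν 1 then (1 : ℝ) else 0) +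
       (if w = -Pi.single μ 1 - Pi.single ν 1 then (1 : ℝ) else 0)))) =
      if (∑ μ : Fin 4, |w μ|) = 2 ∧ (∀ μ : Fin 4, |w μ| ≤ 1) then 2 else 0 := by
  by_cases hbox : ∀ μ : Fin 4, |w μ| ≤ 1
  · obtain ⟨a, b, c, d, hw⟩ := exists_box_repr hbox
    have key := box_shell_two a b c d
    rw [hw]
    exact_mod_cast key
  · have hcond : ¬((∑ μ : Fin 4, |w μ|) = 2 ∧ (∀ μ : Fin 4, |w μ| ≤ 1)) := fun h => hbox h.2
    rw [if_neg hcond]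
    push Not at hbox
    obtain ⟨κ, hκ⟩ := hbox
    refine Finset.sum_eq_zero fun μ _ => Finset.sum_eq_zero fun ν _ => ?_
    by_cases hμν : μ = ν
    · rw [if_pos hμν]
    · rw [if_neg hμν]
      have van : ∀ s s' : ℤ, |s| ≤ 1 → |s'| ≤ 1 →
          w ≠ s • (Pi.single μ (1 : ℤ) : Site 4) + s' • (Pi.single ν (1 : ℤ) : Site 4) := by
        intro s s' hs hs' e
        have := abs_shell_two_apply_le hμν κ s s' hs hs'
        rw [← e] at this
        linarith
      have h1 := van 1 1 (by simp) (by simp)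
      have h2 := van 1 (-1) (by simp) (by simp)
      have h3 := van (-1) 1 (by simp) (by simp)
      have h4 := van (-1) (-1) (by simp) (by simp)
      simp only [one_smul, neg_smul, ← sub_eq_add_neg] at h1 h2 h3 h4
      rw [if_neg h1, if_neg h2, if_neg h3, if_neg h4]
      norm_num

/-- **`ĥ` as an explicit combination of indicators** of the `33` vectors `0`, `±e_μ`,
`±e_μ ± e_ν` (`μ ≠ ν`, ordered pairs, each unordered vector counted twice, whence the factor `1/4`). -/
theorem hhat_eq_indicator (w : Site 4) :
    hhat w = 20 * (if w = 0 then 1 else 0) -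
      4 * (∑ μ : Fin 4, ((if w = Pi.single μ 1 then (1 : ℝ) else 0) + (if w = -Pi.single μ 1 then 1 else 0))) +
      1 / 4 * (∑ μ : Fin 4, ∑ ν : Fin 4, (if μ = ν then (0 : ℝ) else
        ((if w = Pi.single μ 1 + Pi.single ν 1 then (1 : ℝ) else 0) +
         (if w = Pi.single μ 1 - Pi.single ν 1 then (1 : ℝ) else 0) +
         (if w = -Pi.single μ 1 + Pi.single ν 1 then (1 : ℝ) else 0) +
         (if w = -Pi.single μ 1 - Pi.single ν 1 then (1 : ℝ) else 0)))) := by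
  rw [shell_one_indicator, shell_two_indicator]
  unfold hhat
  by_cases h0 : w = 0
  · subst h0
    simp
  · rw [if_neg h0, if_neg h0]
    by_cases h1 : (∑ μ : Fin 4, |w μ|) = 1
    · have h2 : ¬((∑ μ : Fin 4, |w μ|) = 2 ∧ (∀ μ : Fin 4, |w μ| ≤ 1)) := by
        rintro ⟨h, -⟩; rw [h1] at h; norm_num at h
      rw [if_pos h1, if_pos h1, if_neg h2]
      norm_num
    · rw [if_neg h1, if_neg h1]
      by_cases h2 : (∑ μ : Fin 4, |w μ|) = 2 ∧ (∀ μ : Fin 4, |w μ| ≤ 1)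
      · rw [if_pos h2, if_pos h2]; norm_num
      · rw [if_neg h2, if_neg h2]; norm_num

/-! ## §3 The `33`-term expansion of `Σ_{z ∈ nbr2 0} ĥ(z) • f z` -/

section Expansion

variable {M : Type*} [AddCommGroup M] [Module ℝ M]

/-- **The `33`-term expansion**: for any `f` with values in a real vector space,
`Σ_{z ∈ nbr2 0} ĥ(z) • f z = 20 f(0) − 4 Σ_μ (f(e_μ) + f(−e_μ))
  + ¼ Σ_{μ ≠ ν} (f(e_μ+e_ν) + f(e_μ−e_ν) + f(−e_μ+e_ν) + f(−e_μ−e_ν))`.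
(Memberships are supplied by unification, never by numeral arguments; see the file header.) -/
theorem sum_nbr2_hhat_smul (f : Site 4 → M) :
    ∑ z ∈ nbr2 0, hhat z • f z =
      (20 : ℝ) • f 0 - (4 : ℝ) • ∑ μ : Fin 4, (f (Pi.single μ 1) + f (-Pi.single μ 1)) +
        (1 / 4 : ℝ) • ∑ μ : Fin 4, ∑ ν : Fin 4, (if μ = ν then (0 : M) else
          (f (Pi.single μ 1 + Pi.single ν 1) + f (Pi.single μ 1 - Pi.single ν 1) +
            f (-Pi.single μ 1 + Pi.single ν 1) + f (-Pi.single μ 1 - Pi.single ν 1))) := by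
  -- expand `ĥ(z) • f z` pointwise into indicator-selected values
  have H : ∀ z : Site 4, hhat z • f z =
      (20 : ℝ) • (if z = 0 then f z else 0) -
        (4 : ℝ) • ∑ μ : Fin 4, ((if z = Pi.single μ 1 then f z else 0) +
          (if z = -Pi.single μ 1 then f z else 0)) +
        (1 / 4 : ℝ) • ∑ μ : Fin 4, ∑ ν : Fin 4, (if μ = ν then (0 : M) else
          ((if z = Pi.single μ 1 + Pi.single ν 1 then f z else 0) +
            (if z = Pi.single μ 1 - Pi.single ν 1 then f z else 0) +
            (if z = -Pi.single μ 1 + Pi.single ν 1 then f z else 0) +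
            (if z = -Pi.single μ 1 - Pi.single ν 1 then f z else 0))) := by
    intro z
    rw [hhat_eq_indicator]
    simp only [add_smul, sub_smul, mul_smul, Finset.sum_smul, ite_smul, one_smul, zero_smul]
  have hA : ∑ z ∈ nbr2 0, (if z = 0 then f z else 0) = f 0 := by
    rw [Finset.sum_ite_eq_of_mem' _ _ _ (self_mem_nbr2 _)]
  have hB : ∑ z ∈ nbr2 0, ∑ μ : Fin 4, ((if z = Pi.single μ 1 then f z else 0) +
      (if z = -Pi.single μ 1 then f z else 0)) =
      ∑ μ : Fin 4, (f (Pi.single μ 1) + f (-Pi.single μ 1)) := by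
    rw [Finset.sum_comm]
    refine Finset.sum_congr rfl fun μ _ => ?_
    rw [Finset.sum_add_distrib, Finset.sum_ite_eq_of_mem' _ _ _ (single_mem_nbr2_zero μ),
      Finset.sum_ite_eq_of_mem' _ _ _ (neg_single_mem_nbr2_zero μ)]
  have hC : ∑ z ∈ nbr2 0, ∑ μ : Fin 4, ∑ ν : Fin 4, (if μ = ν then (0 : M) else
        ((if z = Pi.single μ 1 + Pi.single ν 1 then f z else 0) +
          (if z = Pi.single μ 1 - Pi.single ν 1 then f z else 0) +
          (if z = -Pi.single μ 1 + Pi.single ν 1 then f z else 0) +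
          (if z = -Pi.single μ 1 - Pi.single ν 1 then f z else 0))) =
      ∑ μ : Fin 4, ∑ ν : Fin 4, (if μ = ν then (0 : M) else
        (f (Pi.single μ 1 + Pi.single ν 1) + f (Pi.single μ 1 - Pi.single ν 1) +
          f (-Pi.single μ 1 + Pi.single ν 1) + f (-Pi.single μ 1 - Pi.single ν 1))) := by
    rw [Finset.sum_comm]
    refine Finset.sum_congr rfl fun μ _ => ?_
    rw [Finset.sum_comm]
    refine Finset.sum_congr rfl fun ν _ => ?_
    by_cases h : μ = ν
    · simp only [if_pos h, Finset.sum_const_zero]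
    · simp only [if_neg h]
      rw [Finset.sum_add_distrib, Finset.sum_add_distrib, Finset.sum_add_distrib,
        Finset.sum_ite_eq_of_mem' _ _ _ (single_add_single_mem_nbr2_zero μ ν),
        Finset.sum_ite_eq_of_mem' _ _ _ (single_sub_single_mem_nbr2_zero μ ν),
        Finset.sum_ite_eq_of_mem' _ _ _ (neg_single_add_single_mem_nbr2_zero μ ν),
        Finset.sum_ite_eq_of_mem' _ _ _ (neg_single_sub_single_mem_nbr2_zero μ ν)]
  rw [Finset.sum_congr rfl fun z _ => H z, Finset.sum_add_distrib, Finset.sum_sub_distrib,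
    ← Finset.smul_sum, ← Finset.smul_sum, ← Finset.smul_sum, hA, hB, hC]

end Expansion

/-- `Σ_{z ∈ nbr2 0} |ĥ(z)| ≤ 1620` (crude: `81` points, `|ĥ| ≤ 20`). -/
theorem sum_nbr2_abs_hhat_le : ∑ z ∈ nbr2 0, |hhat z| ≤ 1620 := by
  calc ∑ z ∈ nbr2 0, |hhat z| ≤ ∑ _z ∈ nbr2 0, (20 : ℝ) := Finset.sum_le_sum fun z _ => abs_hhat_le z
    _ = 20 * (nbr2 0).card := by rw [Finset.sum_const, nsmul_eq_mul, mul_comm]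
    _ ≤ 20 * 81 := by
        have := card_nbr2_le 0
        exact mul_le_mul_of_nonneg_left (by exact_mod_cast this) (by norm_num)
    _ = 1620 := by norm_num

/-! ## Registered headline -/

/-- Registered headline of this helper file (aux stub `stub_freeHeatCalculusAux` of crux
stmt-QuantumFields-16786, line `Sketch`): the `33`-term expansion of `Σ_{z ∈ nbr2 0} ĥ(z) f(z)` for
real-valued `f`. -/
theorem stub_freeHeatCalculusAux :
    ∀ f : Site 4 → ℝ, ∑ z ∈ nbr2 0, hhat z • f z =
      (20 : ℝ) • f 0 - (4 : ℝ) • ∑ μ : Fin 4, (f (Pi.single μ 1) + f (-Pi.single μ 1)) +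
        (1 / 4 : ℝ) • ∑ μ : Fin 4, ∑ ν : Fin 4, (if μ = ν then (0 : ℝ) else
          (f (Pi.single μ 1 + Pi.single ν 1) + f (Pi.single μ 1 - Pi.single ν 1) +
            f (-Pi.single μ 1 + Pi.single ν 1) + f (-Pi.single μ 1 - Pi.single ν 1))) :=
  fun f => sum_nbr2_hhat_smul f

end Summit.QuantumFields.QCD.Cruxes.QuarkLoopCoefficient.Sketch.FreeHeatCalculus

end
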